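import Literature.Claims.NS.ClayVariants
import HarnessLib

/-!
# Claim skeleton C50 — Tyhtila 2007, «Analytical solution for 3-dimensional, incompressible Navier-Stokes equations»

**Cite header.** Jussi I. Tyhtila, *Analytical solution for 3-dimensional, incompressible Navier-Stokes
equations (with a suitable external force field)*, arXiv:0707.1976 [physics.gen-ph], text of record
**v5** (24 Jul 2007, latest; 11 pp.; `p.` = PDF page = printed page, `(n)` = the paper's equation
numbers), bib key `Tyhtila2007`. UNREFEREED CLAIM under adjudication (D-0090 NS-claims sweep, cell
`ns-claims`, row C50, tier-3 «SOL» row; assigned by RULING v1.29i) — this file TYPES the claimed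
statement and the text's own intermediate assertions as `Prop`s and asserts none of them; the only
theorems are compositions by pure logic and an algebraic reformulation of Step 4. Nothing here is a
theorem about Navier–Stokes. [cite: Tyhtila2007, abstract p.1; §4.4–§4.5 pp.9–11]

**Claimed statement (verbatim).** Abstract p.1: «This paper provides primarily an analytical ad hoc
-solution for 3-dimensional, incompressible Navier-Stokes equations with a suitable external force
field. The solution turns out to be smooth and integrable, as there is a gaussian decay of amplitudes
present.» §4.4 p.9: «We will show an explicit solution with the aid of an external force field.» §4.5
p.11: «We have provided an analytical solution to the full Navier-Stokes equations that is smooth and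
integrable with the aid of an external force field.» The solution is the EXPLICIT triple of §4.4
(frequencies `A = B = C = 1`, p.9): the «grundfunctions» (48)–(50) p.8 (complex-valued: parameters
`α, β, γ ∈ ℂ` with the incompressibility condition `α + β + γ = 0` (37), time rate
`a = ν((A+B+C)i − 3)` (47)), the force (72)–(74) p.10 and the pressure (78) p.11. Typed as
`ClaimedTheorem`: for every `ν > 0` and all `α, β, γ ∈ ℂ` with `α + β + γ = 0`, the displayed
`(u, p, f)` satisfies the system (3)–(6) p.2 (componentwise momentum equations + divergence) on
`ℝ³ × [0,∞)`, with the fields EXACTLY as printed (complex values, real variables `x, y, z, t`).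

**Clay delta (reference `Literature.Claims.NS.ClayVariants`).** Δ2 EQUATIONS: the fields are
COMPLEX-valued (`i` in every exponent and prefactor; §4 never takes real parts — unlike §3 (28) — and for
the nonlinear system the real part of a complex solution is not a solution): not the real Navier–Stokes
system of `IsNavierStokesSolution`. Δ3 FORCE: `f` is CHOSEN («suppose we have an external force field f
such that (72)–(74)») to cancel the convective cross terms — reverse-engineered, not given; Clay (A)/(B)
take `f ≡ 0` and forced regularity quantifies over ALL forces of class (5). Δ6/Δ7: ONE explicit triple
(«ad hoc -solution») vs (A)'s «∀ datum ∃ solution» / (C)'s non-existence. Δ4/Δ5: Gaussian modulus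
`|e^{…}| = e^{−3νt − r²/2}` — decay/energy are not the issue. No `clay_of_claimed` is provable or
attempted; the printed identification is only «analytical solution to the full Navier-Stokes
equations» (no Clay sentence in the text; the census lists the row as a «wrong problem» candidate).

**Architecture and ORDERED STEP INDEX** (print order):
* Step 1 = `Step_1_shearWave` — §3 (7)–(29) pp.2–4: the unforced «trivial solution»
  `u = (w,w,w)`, `w = e^{−ν(α²+β²+γ²)t} cos(αx+βy+γz)`, `α+β+γ = 0`, `p = c` (28)–(29) solves (1)–(2) with
  `f ≡ 0` (REAL fields; typed over the tree's `IsNavierStokesSolution`). Independent of §4.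
* Step 2 = `Step_2_divergence` — §4.1 (36)–(37) p.5: the grundfunctions are divergence-free iff
  `α + β + γ = 0` (typed with the paper's derivative table §4.2: `∂ₓuₓ = (Aix − x)uₓ` etc., `A=B=C=1`).
* Step 3 = `Step_3_system55` — §4.2–§4.3 (38)–(47), (51)–(53), specialised (55)–(57) p.9: with
  `a = ν(3i − 3)`, the momentum equations (3)–(5) for the grundfunctions ARE the pressure-gradient system
  (55)–(57): `∂p/∂x_k = ν((ix−x)²+(iy−y)²+(iz−z)²+4(i−1))u_k − (cross terms (38)–(40)) + f_k`, the cross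
  terms being (63)–(68) p.10. Typed as the equivalence between the PDE form `MomentumPDE` (derivatives
  via Mathlib `deriv` in each real variable) and the algebraic form `Sys55`.
* Step 4 = `Step_4_chooseBackwards` — §4.4 (58)–(62) pp.9–10: «Let us multiply the first equation by
  (xi − x) … and sum … Using the property of zero-divergence, we will get just (58) = (59). Let us choose
  backwards so that ∂p/∂x = −(uₓu_y/y + uₓu_z/z) + fₓ (60), (61), (62)»: the system (60)–(62) is put IN
  PLACE of (55)–(57), i.e. a pair `(p, f)` satisfying (60)–(62) is taken to satisfy (55)–(57). Typed as
  that implication for the grundfunctions; `step4_iff_remainderVanishes` (proved, algebra) shows it says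
  exactly that the viscous remainder `ν((ix−x)²+(iy−y)²+(iz−z)²+4(i−1))u_k` vanishes identically.
* Step 5 = `Step_5_explicit6062` — §4.4 (63)–(78) pp.10–11: with `g = e^{ν(6i−6)t−r²+ir²}`, the force
  (72)–(74) and the pressure gradient (75)–(77) of `p = −(1+i)g` (78) satisfy (60)–(62).
COMPOSITION: `claim_of_steps : Step_2_divergence → Step_3_system55 → Step_4_chooseBackwards →
Step_5_explicit6062 → ClaimedTheorem` PROVED (pure logic). Kernel note for the refuter: Step 4 is
decidable by evaluation at one point (e.g. `ν = 1, α = 1, β = −1, γ = 0, (x,y,z,t) = (0,1,1,0)`: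
(60) holds there with both sides `0`, (55) requires in addition `ν·bracket(0,1,1)·uₓ = −4ν uₓ ≠ 0` — see
`RemainderVanishes`), i.e. `¬ Step_4_chooseBackwards` needs only `Complex.exp_ne_zero` and arithmetic; Steps 1,
2, 3, 5 read TRUE (routine calculus/algebra; (67) prints the exponent `i(x+y+z)` for `i(x²+y²+z²)`, a
typo absorbed into `g`).

WHAT THIS IS NOT: not a claim about NS regularity or blow-up; not a claim about any author beyond the
typed locator.
-/

open Set Complex
open Literature.Analysis.FluidPDE
open scoped ContDiff

namespace Literature.Claims.NS.Tyhtila2007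

noncomputable section

/-! ## §3: the unforced shear wave (real fields) -/

/-- Physical space `ℝ³`. [folklore] -/
abbrev R3 : Type := EuclideanSpace ℝ (Fin 3)

/-- The §3 «trivial solution» (28): `w(x,t) = e^{−ν(α²+β²+γ²)t} cos(αx₁ + βx₂ + γx₃)` in every component,
`u = (w, w, w)`. [cite: Tyhtila2007, (28) p.4] -/
def shearWave (ν α β γ : ℝ) (t : ℝ) (x : R3) : R3 :=
  (Real.exp (-(ν * (α ^ 2 + β ^ 2 + γ ^ 2)) * t) * Real.cos (α * x 0 + β * x 1 + γ * x 2)) •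
    (EuclideanSpace.single 0 1 + EuclideanSpace.single 1 1 + EuclideanSpace.single 2 1)

/-- **Step 1 — §3 (7)–(29) pp.2–4**: for `α + β + γ = 0` («the incompressibility condition» (12)) and
any constant pressure `p = c` (29), the shear wave (28) is a smooth solution of the UNFORCED system
(1)–(2) on `ℝ³ × [0,∞)`. (Independent of §4; a classical plane shear wave.) [cite: Tyhtila2007, (27)–(29) p.4] -/
def Step_1_shearWave : Prop :=
  ∀ ν α β γ c : ℝ, 0 < ν → α + β + γ = 0 →
    IsSmoothOnHalfSpace (shearWave ν α β γ) ∧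
      IsNavierStokesSolution ν 0 (shearWave ν α β γ 0) (shearWave ν α β γ) (fun _ _ => c)

/-! ## §4.4: the explicit complex-valued triple (A = B = C = 1) -/

/-- The common exponential of (48)–(50) with `A = B = C = 1`, `a = ν(3i − 3)` (47):
`E = exp(ν(3i−3)t − (x²+y²+z²)/2 + (i/2)(x²+y²+z²))`. [cite: Tyhtila2007, (47)–(50) p.8] -/
def E (ν : ℝ) (x y z t : ℝ) : ℂ :=
  exp ((ν : ℂ) * (3 * I - 3) * t - ((x : ℂ) ^ 2 + y ^ 2 + z ^ 2) / 2 +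
    I / 2 * ((x : ℂ) ^ 2 + y ^ 2 + z ^ 2))

/-- `uₓ = α(iy − y)(iz − z)E` ((48) with `B = C = 1`). [cite: Tyhtila2007, (48) p.8] -/
def ux (ν : ℝ) (α : ℂ) (x y z t : ℝ) : ℂ := α * (I * y - y) * (I * z - z) * E ν x y z t

/-- `u_y = β(ix − x)(iz − z)E` ((49) with `A = C = 1`). [cite: Tyhtila2007, (49) p.8] -/
def uy (ν : ℝ) (β : ℂ) (x y z t : ℝ) : ℂ := β * (I * x - x) * (I * z - z) * E ν x y z t

/-- `u_z = γ(ix − x)(iy − y)E` ((50) with `A = B = 1`). [cite: Tyhtila2007, (50) p.8] -/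
def uz (ν : ℝ) (γ : ℂ) (x y z t : ℝ) : ℂ := γ * (I * x - x) * (I * y - y) * E ν x y z t

/-- `g = e^{ν(6i−6)t − (x²+y²+z²) + i(x²+y²+z²)}` ((63)–(68) p.10; `= E²`).
[cite: Tyhtila2007, (63) p.10] -/
def g (ν : ℝ) (x y z t : ℝ) : ℂ :=
  exp ((ν : ℂ) * (6 * I - 6) * t - ((x : ℂ) ^ 2 + y ^ 2 + z ^ 2) + I * ((x : ℂ) ^ 2 + y ^ 2 + z ^ 2))

/-- The cross terms of the `x`-equation, `uₓu_y/y + uₓu_z/z = −4αβxz²g − 4αγxy²g` ((63), (64)).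
[cite: Tyhtila2007, (38) p.6; (63)–(64) p.10] -/
def crossX (ν : ℝ) (α β γ : ℂ) (x y z t : ℝ) : ℂ :=
  -4 * α * β * x * z ^ 2 * g ν x y z t + (-4 * α * γ * x * y ^ 2 * g ν x y z t)

/-- The cross terms of the `y`-equation, `u_yuₓ/x + u_yu_z/z = −4βαyz²g − 4βγyx²g` ((66), (68)).
[cite: Tyhtila2007, (39) p.7; (66), (68) p.10] -/
def crossY (ν : ℝ) (α β γ : ℂ) (x y z t : ℝ) : ℂ :=
  -4 * β * α * y * z ^ 2 * g ν x y z t + (-4 * β * γ * y * x ^ 2 * g ν x y z t)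

/-- The cross terms of the `z`-equation, `u_zuₓ/x + u_zu_y/y = −4αγzy²g − 4βγzx²g` ((67), (65); (67)
prints the exponent `i(x+y+z)`, read as the `g` of the other five lines).
[cite: Tyhtila2007, (40) p.7; (65), (67) p.10] -/
def crossZ (ν : ℝ) (α β γ : ℂ) (x y z t : ℝ) : ℂ :=
  -4 * α * γ * z * y ^ 2 * g ν x y z t + (-4 * β * γ * z * x ^ 2 * g ν x y z t)

/-- The chosen external force (72)–(74) p.10. [cite: Tyhtila2007, (72)–(74) p.10] -/
def fx (ν : ℝ) (α β γ : ℂ) (x y z t : ℝ) : ℂ :=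
  -4 * α * (β * z ^ 2 + γ * y ^ 2) * x * g ν x y z t + 4 * x * g ν x y z t

/-- The chosen external force, `y`-component (73). [cite: Tyhtila2007, (73) p.10] -/
def fy (ν : ℝ) (α β γ : ℂ) (x y z t : ℝ) : ℂ :=
  -4 * β * (α * z ^ 2 + γ * x ^ 2) * y * g ν x y z t + 4 * y * g ν x y z t

/-- The chosen external force, `z`-component (74). [cite: Tyhtila2007, (74) p.10] -/
def fz (ν : ℝ) (α β γ : ℂ) (x y z t : ℝ) : ℂ :=
  -4 * γ * (α * y ^ 2 + β * x ^ 2) * z * g ν x y z t + 4 * z * g ν x y z t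

/-- The pressure (78) p.11: `p = −(1+i) g` (+ constant, taken `0`). [cite: Tyhtila2007, (78) p.11] -/
def pr (ν : ℝ) (x y z t : ℝ) : ℂ := -(1 + I) * g ν x y z t

/-- The viscous bracket of (55)–(57) p.9 (`A = B = C = 1`): `(ix−x)² + (iy−y)² + (iz−z)² + 4(i−1)`
(the `2(i−1) + 2(i−1)` of (55)). [cite: Tyhtila2007, (55)–(57) p.9] -/
def bracket (x y z : ℝ) : ℂ :=
  (I * x - x) ^ 2 + (I * y - y) ^ 2 + (I * z - z) ^ 2 + 4 * (I - 1)

/-- The viscous REMAINDER that distinguishes (55)–(57) from (60)–(62) VANISHES at `(x,y,z,t)`: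
`ν · bracket · u_k = 0` for `k = x, y, z`. [cite: Tyhtila2007, (55)–(57) p.9 vs (60)–(62) pp.9–10] -/
def RemainderVanishes (ν : ℝ) (α β γ : ℂ) (x y z t : ℝ) : Prop :=
  (ν : ℂ) * bracket x y z * ux ν α x y z t = 0 ∧ (ν : ℂ) * bracket x y z * uy ν β x y z t = 0 ∧
    (ν : ℂ) * bracket x y z * uz ν γ x y z t = 0

/-! ## Partial derivatives of complex fields of the real variables `(x, y, z, t)` -/

/-- `∂/∂x`. [folklore] -/
def pdx (φ : ℝ → ℝ → ℝ → ℝ → ℂ) (x y z t : ℝ) : ℂ := deriv (fun s => φ s y z t) x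
/-- `∂/∂y`. [folklore] -/
def pdy (φ : ℝ → ℝ → ℝ → ℝ → ℂ) (x y z t : ℝ) : ℂ := deriv (fun s => φ x s z t) y
/-- `∂/∂z`. [folklore] -/
def pdz (φ : ℝ → ℝ → ℝ → ℝ → ℂ) (x y z t : ℝ) : ℂ := deriv (fun s => φ x y s t) z
/-- `∂/∂t` (within `[0,∞)`). [folklore] -/
def pdt (φ : ℝ → ℝ → ℝ → ℝ → ℂ) (x y z t : ℝ) : ℂ := derivWithin (fun s => φ x y z s) (Ici 0) t

/-- The Laplacian `∂²/∂x² + ∂²/∂y² + ∂²/∂z²` of a complex field. [cite: Tyhtila2007, (3)–(5) p.2] -/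
def lap (φ : ℝ → ℝ → ℝ → ℝ → ℂ) (x y z t : ℝ) : ℂ :=
  pdx (pdx φ) x y z t + pdy (pdy φ) x y z t + pdz (pdz φ) x y z t

/-- The convective term `uₓ ∂ₓφ + u_y ∂_yφ + u_z ∂_zφ` for a component `φ`. [cite: Tyhtila2007, (3)–(5) p.2] -/
def conv (u₁ u₂ u₃ φ : ℝ → ℝ → ℝ → ℝ → ℂ) (x y z t : ℝ) : ℂ :=
  u₁ x y z t * pdx φ x y z t + u₂ x y z t * pdy φ x y z t + u₃ x y z t * pdz φ x y z t

/-- **The momentum equations (3)–(5) p.2, componentwise, for a (complex-valued) triple `(u, p, f)` on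
`ℝ³ × [0,∞)`**: `∂ₜu_k + ∂_k p = ν Δu_k − (u·∇)u_k + f_k`. [cite: Tyhtila2007, (3)–(5) p.2] -/
def MomentumPDE (ν : ℝ) (u₁ u₂ u₃ p f₁ f₂ f₃ : ℝ → ℝ → ℝ → ℝ → ℂ) : Prop :=
  ∀ x y z t : ℝ, 0 ≤ t →
    pdt u₁ x y z t + pdx p x y z t = ν * lap u₁ x y z t - conv u₁ u₂ u₃ u₁ x y z t + f₁ x y z t ∧
    pdt u₂ x y z t + pdy p x y z t = ν * lap u₂ x y z t - conv u₁ u₂ u₃ u₂ x y z t + f₂ x y z t ∧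
    pdt u₃ x y z t + pdz p x y z t = ν * lap u₃ x y z t - conv u₁ u₂ u₃ u₃ x y z t + f₃ x y z t

/-- **Incompressibility (6) p.2**: `∂ₓuₓ + ∂_yu_y + ∂_zu_z = 0`. [cite: Tyhtila2007, (6) p.2] -/
def DivPDE (u₁ u₂ u₃ : ℝ → ℝ → ℝ → ℝ → ℂ) : Prop :=
  ∀ x y z t : ℝ, 0 ≤ t → pdx u₁ x y z t + pdy u₂ x y z t + pdz u₃ x y z t = 0

/-! ## The algebraic systems (55)–(57) and (60)–(62) for the explicit triple -/

/-- The system (55)–(57) p.9 for the explicit fields, with the pressure gradient (75)–(77)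
(`∂_k p = 4x_k g`, the gradient of (78)) on the left: `4x_k g = ν·bracket·u_k − cross_k + f_k`.
[cite: Tyhtila2007, (55)–(57) p.9; (75)–(78) pp.10–11] -/
def Sys55 (ν : ℝ) (α β γ : ℂ) : Prop :=
  ∀ x y z t : ℝ, 0 ≤ t →
    4 * x * g ν x y z t = ν * bracket x y z * ux ν α x y z t - crossX ν α β γ x y z t + fx ν α β γ x y z t ∧
    4 * y * g ν x y z t = ν * bracket x y z * uy ν β x y z t - crossY ν α β γ x y z t + fy ν α β γ x y z t ∧
    4 * z * g ν x y z t = ν * bracket x y z * uz ν γ x y z t - crossZ ν α β γ x y z t + fz ν α β γ x y z t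

/-- The system (60)–(62) pp.9–10 («Let us choose backwards so that …») for the explicit fields with
(75)–(77) on the left: `4x_k g = −cross_k + f_k`. [cite: Tyhtila2007, (60)–(62) pp.9–10; (75)–(77) p.10–11] -/
def Sys60 (ν : ℝ) (α β γ : ℂ) : Prop :=
  ∀ x y z t : ℝ, 0 ≤ t →
    4 * x * g ν x y z t = -crossX ν α β γ x y z t + fx ν α β γ x y z t ∧
    4 * y * g ν x y z t = -crossY ν α β γ x y z t + fy ν α β γ x y z t ∧
    4 * z * g ν x y z t = -crossZ ν α β γ x y z t + fz ν α β γ x y z t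

/-! ## The claimed statement -/

/-- **The claimed theorem (as printed; abstract p.1, §4.4 p.9 «We will show an explicit solution with
the aid of an external force field», §4.5 p.11)**: for every `ν > 0` and all `α, β, γ ∈ ℂ` with
`α + β + γ = 0`, the explicit triple — velocity (48)–(50) with `A = B = C = 1`, pressure (78), force
(72)–(74) — satisfies the incompressible system (3)–(6) on `ℝ³ × [0,∞)` (complex-valued fields, as
printed). [cite: Tyhtila2007, abstract p.1; §4.4 (72)–(78) pp.9–11; §4.5 p.11] -/
def ClaimedTheorem : Prop :=
  ∀ ν : ℝ, 0 < ν → ∀ α β γ : ℂ, α + β + γ = 0 →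
    DivPDE (ux ν α) (uy ν β) (uz ν γ) ∧
    MomentumPDE ν (ux ν α) (uy ν β) (uz ν γ) (pr ν) (fx ν α β γ) (fy ν α β γ) (fz ν α β γ)

/-! ## The steps of §4 (none asserted) -/

/-- **Step 2 — §4.1 (36)–(37) p.5 (with the derivative table of §4.2)**: the grundfunctions are
divergence-free for `α + β + γ = 0` («∇·u = (Aix − x)uₓ + (Biy − y)u_y + (Ciz − z)u_z = 0 ∀x,y,z,t if
and only if α + β + γ = 0»). [cite: Tyhtila2007, (36)–(37) p.5] -/
def Step_2_divergence : Prop :=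
  ∀ ν : ℝ, 0 < ν → ∀ α β γ : ℂ, α + β + γ = 0 → DivPDE (ux ν α) (uy ν β) (uz ν γ)

/-- **Step 3 — §4.2–§4.3 (38)–(47), (51)–(53)/(55)–(57) pp.5–9**: by the derivative table of §4.2 and the
choice `a = ν(3i − 3)` (47), the momentum equations (3)–(5) for the explicit triple are EQUIVALENT to
the algebraic system (55)–(57) (here with (75)–(77) substituted for `∇p`, which is the gradient of the
printed `p` (78)). [cite: Tyhtila2007, (41)–(47) p.8; (55)–(57) p.9] -/
def Step_3_system55 : Prop :=
  ∀ ν : ℝ, 0 < ν → ∀ α β γ : ℂ, α + β + γ = 0 →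
    (MomentumPDE ν (ux ν α) (uy ν β) (uz ν γ) (pr ν) (fx ν α β γ) (fy ν α β γ) (fz ν α β γ) ↔
      Sys55 ν α β γ)

/-- **Step 4 — §4.4 (58)–(62) pp.9–10, «Let us choose backwards so that …»**: after contracting
(55)–(57) against `((i−1)x, (i−1)y, (i−1)z)` (58)–(59), the system (60)–(62) is put in place of
(55)–(57): a pair `(p, f)` satisfying (60)–(62) is taken to satisfy (55)–(57). Typed for the explicit
triple as that implication; equivalently (`step4_iff_remainderVanishes`) the viscous remainder
`ν((ix−x)²+(iy−y)²+(iz−z)²+4(i−1))u_k` vanishes identically for `t ≥ 0`.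
[cite: Tyhtila2007, (58)–(62) pp.9–10] -/
def Step_4_chooseBackwards : Prop :=
  ∀ ν : ℝ, 0 < ν → ∀ α β γ : ℂ, α + β + γ = 0 → (Sys60 ν α β γ → Sys55 ν α β γ)

/-- **Step 5 — §4.4 (63)–(78) pp.10–11**: with the cross terms (63)–(68), the force (72)–(74) and
`p = −(1+i)g` (78) (gradient (75)–(77)), the system (60)–(62) holds.
[cite: Tyhtila2007, (63)–(78) pp.10–11] -/
def Step_5_explicit6062 : Prop :=
  ∀ ν : ℝ, 0 < ν → ∀ α β γ : ℂ, α + β + γ = 0 → Sys60 ν α β γ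

/-! ## Compositions and the algebraic content of Step 4 (pure logic / `ring`) -/

/-- **COMPOSITION** (the paper's logic): Steps 2–5 give the claimed explicit solution.
[cite: Tyhtila2007, §4 pp.5–11] -/
theorem claim_of_steps (h2 : Step_2_divergence) (h3 : Step_3_system55) (h4 : Step_4_chooseBackwards)
    (h5 : Step_5_explicit6062) : ClaimedTheorem := by
  intro ν hν α β γ hs
  exact ⟨h2 ν hν α β γ hs, (h3 ν hν α β γ hs).mpr (h4 ν hν α β γ hs (h5 ν hν α β γ hs))⟩

/-- Step 4, unfolded: given (60)–(62), the system (55)–(57) holds iff the viscous remainder vanishes at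
every point with `t ≥ 0` — the algebraic content of «choose backwards».
[cite: Tyhtila2007, (55)–(57) p.9 vs (60)–(62) pp.9–10] -/
theorem sys55_iff_remainder_of_sys60 {ν : ℝ} {α β γ : ℂ} (h60 : Sys60 ν α β γ) :
    Sys55 ν α β γ ↔ ∀ x y z t : ℝ, 0 ≤ t → RemainderVanishes ν α β γ x y z t := by
  constructor
  · intro h55 x y z t ht
    obtain ⟨a1, a2, a3⟩ := h55 x y z t ht
    obtain ⟨b1, b2, b3⟩ := h60 x y z t ht
    exact ⟨by linear_combination b1 - a1, by linear_combination b2 - a2,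
      by linear_combination b3 - a3⟩
  · intro hrem x y z t ht
    obtain ⟨b1, b2, b3⟩ := h60 x y z t ht
    obtain ⟨h1, h2, h3⟩ := hrem x y z t ht
    exact ⟨by linear_combination b1 - h1, by linear_combination b2 - h2,
      by linear_combination b3 - h3⟩

/-- Step 4 says exactly: for all admissible parameters, (60)–(62) forces the remainder to vanish
(given Step 5, which supplies (60)–(62)). [cite: Tyhtila2007, (58)–(62) pp.9–10] -/
theorem step4_iff_remainderVanishes (h5 : Step_5_explicit6062) :
    Step_4_chooseBackwards ↔
      ∀ ν : ℝ, 0 < ν → ∀ α β γ : ℂ, α + β + γ = 0 →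
        ∀ x y z t : ℝ, 0 ≤ t → RemainderVanishes ν α β γ x y z t := by
  constructor
  · intro h4 ν hν α β γ hs
    exact (sys55_iff_remainder_of_sys60 (h5 ν hν α β γ hs)).mp (h4 ν hν α β γ hs (h5 ν hν α β γ hs))
  · intro h ν hν α β γ hs h60
    exact (sys55_iff_remainder_of_sys60 h60).mpr (h ν hν α β γ hs)

/-! ## Discharged TRUE step: Step 2 (append-only; ns-claims D-0026 debt pass, typist-9 g4)

§4.1 (36)–(37) p.5: `∇·u = α(iy−y)(iz−z)∂ₓE + β(ix−x)(iz−z)∂_yE + γ(ix−x)(iy−y)∂_zE` with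
`∂_kE = (i−1)x_kE`, i.e. `∇·u = (i−1)³xyz·E·(α+β+γ) = 0` exactly when `α + β + γ = 0` (we use the
printed direction). Steps 1 and 5 are already kernel-true on the Summits side
(`SoloSalvageTyhtila2007`, `SoloRefuteTyhtila2007.step5_explicit6062_holds`); Step 4 is the row's
locator (#77); nothing here touches them. -/

/-- Chain rule for the common exponential: `d/ds exp(A + ((i−1)/2)s²) = (i−1)s·exp(A + ((i−1)/2)s²)`
for a real variable `s` and a complex constant `A`. [folklore] -/
private theorem hasDerivAt_cexp_quadratic (A : ℂ) (x : ℝ) :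
    HasDerivAt (fun s : ℝ => Complex.exp (A + (I - 1) / 2 * (s : ℂ) ^ 2))
      ((I - 1) * x * Complex.exp (A + (I - 1) / 2 * (x : ℂ) ^ 2)) x := by
  have h1 : HasDerivAt (fun s : ℝ => (s : ℂ)) 1 x := by
    simpa using (hasDerivAt_id x).ofReal_comp
  have h2 : HasDerivAt (fun s : ℝ => A + (I - 1) / 2 * (s : ℂ) ^ 2)
      ((I - 1) / 2 * (((2 : ℕ) : ℂ) * (x : ℂ) ^ (2 - 1) * 1)) x :=
    ((h1.pow 2).const_mul ((I - 1) / 2)).const_add A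
  convert h2.cexp using 1
  push_cast
  ring

/-- `∂ₓE = (i−1)x·E` ((41) p.8 with `A = 1`, `a`-independent). [cite: Tyhtila2007, (41) p.8] -/
private theorem hasDerivAt_E_x (ν : ℝ) (x y z t : ℝ) :
    HasDerivAt (fun s : ℝ => E ν s y z t) ((I - 1) * x * E ν x y z t) x := by
  set A : ℂ := (ν : ℂ) * (3 * I - 3) * t + (I - 1) / 2 * ((y : ℂ) ^ 2 + (z : ℂ) ^ 2) with hA
  have hfun : (fun s : ℝ => E ν s y z t) =
      fun s : ℝ => Complex.exp (A + (I - 1) / 2 * (s : ℂ) ^ 2) := by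
    funext s
    simp only [E, hA]
    congr 1
    ring
  have hval : E ν x y z t = Complex.exp (A + (I - 1) / 2 * (x : ℂ) ^ 2) := congrFun hfun x
  rw [hfun, hval]
  exact hasDerivAt_cexp_quadratic A x

/-- `∂_yE = (i−1)y·E` ((42) p.8 with `B = 1`). [cite: Tyhtila2007, (42) p.8] -/
private theorem hasDerivAt_E_y (ν : ℝ) (x y z t : ℝ) :
    HasDerivAt (fun s : ℝ => E ν x s z t) ((I - 1) * y * E ν x y z t) y := by
  set A : ℂ := (ν : ℂ) * (3 * I - 3) * t + (I - 1) / 2 * ((x : ℂ) ^ 2 + (z : ℂ) ^ 2) with hA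
  have hfun : (fun s : ℝ => E ν x s z t) =
      fun s : ℝ => Complex.exp (A + (I - 1) / 2 * (s : ℂ) ^ 2) := by
    funext s
    simp only [E, hA]
    congr 1
    ring
  have hval : E ν x y z t = Complex.exp (A + (I - 1) / 2 * (y : ℂ) ^ 2) := congrFun hfun y
  rw [hfun, hval]
  exact hasDerivAt_cexp_quadratic A y

/-- `∂_zE = (i−1)z·E` ((43) p.8 with `C = 1`). [cite: Tyhtila2007, (43) p.8] -/
private theorem hasDerivAt_E_z (ν : ℝ) (x y z t : ℝ) :
    HasDerivAt (fun s : ℝ => E ν x y s t) ((I - 1) * z * E ν x y z t) z := by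
  set A : ℂ := (ν : ℂ) * (3 * I - 3) * t + (I - 1) / 2 * ((x : ℂ) ^ 2 + (y : ℂ) ^ 2) with hA
  have hfun : (fun s : ℝ => E ν x y s t) =
      fun s : ℝ => Complex.exp (A + (I - 1) / 2 * (s : ℂ) ^ 2) := by
    funext s
    simp only [E, hA]
    congr 1
    ring
  have hval : E ν x y z t = Complex.exp (A + (I - 1) / 2 * (z : ℂ) ^ 2) := congrFun hfun z
  rw [hfun, hval]
  exact hasDerivAt_cexp_quadratic A z

/-- `∂ₓuₓ = α(iy−y)(iz−z)(i−1)x·E` ((36) p.5, first term). [cite: Tyhtila2007, (36) p.5] -/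
private theorem pdx_ux (ν : ℝ) (α : ℂ) (x y z t : ℝ) :
    pdx (ux ν α) x y z t = α * (I * y - y) * (I * z - z) * ((I - 1) * x * E ν x y z t) := by
  unfold pdx ux
  exact ((hasDerivAt_E_x ν x y z t).const_mul (α * (I * y - y) * (I * z - z))).deriv

/-- `∂_yu_y = β(ix−x)(iz−z)(i−1)y·E` ((36) p.5, second term). [cite: Tyhtila2007, (36) p.5] -/
private theorem pdy_uy (ν : ℝ) (β : ℂ) (x y z t : ℝ) :
    pdy (uy ν β) x y z t = β * (I * x - x) * (I * z - z) * ((I - 1) * y * E ν x y z t) := by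
  unfold pdy uy
  exact ((hasDerivAt_E_y ν x y z t).const_mul (β * (I * x - x) * (I * z - z))).deriv

/-- `∂_zu_z = γ(ix−x)(iy−y)(i−1)z·E` ((36) p.5, third term). [cite: Tyhtila2007, (36) p.5] -/
private theorem pdz_uz (ν : ℝ) (γ : ℂ) (x y z t : ℝ) :
    pdz (uz ν γ) x y z t = γ * (I * x - x) * (I * y - y) * ((I - 1) * z * E ν x y z t) := by
  unfold pdz uz
  exact ((hasDerivAt_E_z ν x y z t).const_mul (γ * (I * x - x) * (I * y - y))).deriv

/-- **STEP 2 holds** (§4.1 (36)–(37) p.5): for `α + β + γ = 0` the explicit triple (48)–(50)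
(`A = B = C = 1`) is divergence-free on `ℝ³ × [0,∞)`: `∇·u = (i−1)³xyz·E·(α+β+γ) = 0`. Discharge of
the typist's «reads TRUE» flag (routine calculus); no bearing on the row's verdict (#77, false lemma @
`Step_4_chooseBackwards`). [cite: Tyhtila2007, (36)–(37) p.5] -/
theorem step_2_divergence_holds : Step_2_divergence := by
  intro ν _hν α β γ hsum x y z t _ht
  rw [pdx_ux, pdy_uy, pdz_uz]
  linear_combination ((I - 1) ^ 3 * x * y * z * E ν x y z t) * hsum

/-! ## Discharged TRUE step: Step 3 (append-only; ns-claims D-0026 debt pass, typist-5 g6)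

§4.2–§4.3 (38)–(47), (55)–(57) pp.5–9. With `E = exp(ν(3i−3)t + ((i−1)/2)(x²+y²+z²))` one has
`∂ₜu_k = 3ν(i−1)u_k`, `∂ₖE = (i−1)x_kE`, `∂ₖg = 2(i−1)x_kg`, `g = E²`, `∂ₓp = −(1+i)·2(i−1)x g = 4x g`,
`Δuₓ = [(i−1)²(x²+y²+z²) + 7(i−1)]uₓ`, and `(u·∇)uₓ = uₓu_y/y + uₓu_z/z + (i−1)³xyz E (α+β+γ) uₓ`; so on
the divergence-free family `α+β+γ = 0` the momentum equations for the explicit triple are, point by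
point, the system (55)–(57) with the bracket `(ix−x)²+(iy−y)²+(iz−z)²+4(i−1)` (the `∂ₜ` term cancels
`3ν(i−1)` of the Laplacian's `7ν(i−1)`). The row's locator `Step_4_chooseBackwards` (#77) and Step 5
are untouched; nothing here bears on the verdict. -/

/-- `d/ds exp(A s + B) = A exp(A s + B)` for a real variable `s`. [folklore] -/
private theorem hasDerivAt_cexp_affine (A B : ℂ) (t : ℝ) :
    HasDerivAt (fun s : ℝ => Complex.exp (A * (s : ℂ) + B)) (A * Complex.exp (A * (t : ℂ) + B)) t := by
  have h1 : HasDerivAt (fun s : ℝ => (s : ℂ)) 1 t := by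
    simpa using (hasDerivAt_id t).ofReal_comp
  have h2 : HasDerivAt (fun s : ℝ => A * (s : ℂ) + B) (A * 1) t := (h1.const_mul A).add_const B
  convert h2.cexp using 1
  ring

/-- `d/ds exp(B + c s²) = 2 c s exp(B + c s²)` for a real variable `s`. [folklore] -/
private theorem hasDerivAt_cexp_const_mul_sq (B c : ℂ) (x : ℝ) :
    HasDerivAt (fun s : ℝ => Complex.exp (B + c * (s : ℂ) ^ 2))
      (2 * c * x * Complex.exp (B + c * (x : ℂ) ^ 2)) x := by
  have h1 : HasDerivAt (fun s : ℝ => (s : ℂ)) 1 x := by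
    simpa using (hasDerivAt_id x).ofReal_comp
  have h2 : HasDerivAt (fun s : ℝ => B + c * (s : ℂ) ^ 2)
      (c * (((2 : ℕ) : ℂ) * (x : ℂ) ^ (2 - 1) * 1)) x :=
    ((h1.pow 2).const_mul c).const_add B
  convert h2.cexp using 1
  push_cast
  ring

/-- `∂ₜE = ν(3i−3)·E` (the choice `a = ν(3i−3)`, (47) p.8). [cite: Tyhtila2007, (47) p.8] -/
private theorem hasDerivAt_E_t (ν : ℝ) (x y z t : ℝ) :
    HasDerivAt (fun s : ℝ => E ν x y z s) ((ν : ℂ) * (3 * I - 3) * E ν x y z t) t := by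
  set A : ℂ := (ν : ℂ) * (3 * I - 3) with hA
  set B : ℂ := -(((x : ℂ) ^ 2 + y ^ 2 + z ^ 2) / 2) + I / 2 * ((x : ℂ) ^ 2 + y ^ 2 + z ^ 2) with hB
  have hfun : (fun s : ℝ => E ν x y z s) = fun s : ℝ => Complex.exp (A * (s : ℂ) + B) := by
    funext s
    simp only [E, hA, hB]
    congr 1
    ring
  have hval : E ν x y z t = Complex.exp (A * (t : ℂ) + B) := congrFun hfun t
  rw [hfun, hval]
  exact hasDerivAt_cexp_affine A B t

/-- `∂ₓg = 2(i−1)x·g` ((75) p.10: `∂ₓp = −(1+i)∂ₓg`). [cite: Tyhtila2007, (63), (75) p.10] -/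
private theorem hasDerivAt_g_x (ν : ℝ) (x y z t : ℝ) :
    HasDerivAt (fun s : ℝ => g ν s y z t) (2 * (I - 1) * x * g ν x y z t) x := by
  set B : ℂ := (ν : ℂ) * (6 * I - 6) * t + (I - 1) * ((y : ℂ) ^ 2 + (z : ℂ) ^ 2) with hB
  have hfun : (fun s : ℝ => g ν s y z t) = fun s : ℝ => Complex.exp (B + (I - 1) * (s : ℂ) ^ 2) := by
    funext s
    simp only [g, hB]
    congr 1
    ring
  have hval : g ν x y z t = Complex.exp (B + (I - 1) * (x : ℂ) ^ 2) := congrFun hfun x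
  rw [hfun, hval]
  exact hasDerivAt_cexp_const_mul_sq B (I - 1) x

/-- `∂_yg = 2(i−1)y·g` ((76) p.11). [cite: Tyhtila2007, (76) p.11] -/
private theorem hasDerivAt_g_y (ν : ℝ) (x y z t : ℝ) :
    HasDerivAt (fun s : ℝ => g ν x s z t) (2 * (I - 1) * y * g ν x y z t) y := by
  set B : ℂ := (ν : ℂ) * (6 * I - 6) * t + (I - 1) * ((x : ℂ) ^ 2 + (z : ℂ) ^ 2) with hB
  have hfun : (fun s : ℝ => g ν x s z t) = fun s : ℝ => Complex.exp (B + (I - 1) * (s : ℂ) ^ 2) := by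
    funext s
    simp only [g, hB]
    congr 1
    ring
  have hval : g ν x y z t = Complex.exp (B + (I - 1) * (y : ℂ) ^ 2) := congrFun hfun y
  rw [hfun, hval]
  exact hasDerivAt_cexp_const_mul_sq B (I - 1) y

/-- `∂_zg = 2(i−1)z·g` ((77) p.11). [cite: Tyhtila2007, (77) p.11] -/
private theorem hasDerivAt_g_z (ν : ℝ) (x y z t : ℝ) :
    HasDerivAt (fun s : ℝ => g ν x y s t) (2 * (I - 1) * z * g ν x y z t) z := by
  set B : ℂ := (ν : ℂ) * (6 * I - 6) * t + (I - 1) * ((x : ℂ) ^ 2 + (y : ℂ) ^ 2) with hB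
  have hfun : (fun s : ℝ => g ν x y s t) = fun s : ℝ => Complex.exp (B + (I - 1) * (s : ℂ) ^ 2) := by
    funext s
    simp only [g, hB]
    congr 1
    ring
  have hval : g ν x y z t = Complex.exp (B + (I - 1) * (z : ℂ) ^ 2) := congrFun hfun z
  rw [hfun, hval]
  exact hasDerivAt_cexp_const_mul_sq B (I - 1) z

/-- `g = E²` ((63) p.10 vs (47)–(50) p.8: the exponent of `g` is twice that of `E`).
[cite: Tyhtila2007, (63) p.10] -/
private theorem g_eq_E_sq (ν : ℝ) (x y z t : ℝ) : g ν x y z t = E ν x y z t ^ 2 := by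
  rw [E, sq, ← Complex.exp_add, g]
  congr 1
  ring

/-! ### One-variable derivative patterns for `P(s)·F(s)` with `F' = (i−1)sF` -/

/-- `d/ds (c F) = c (i−1) s F`. [folklore] -/
private theorem deriv_diag {F : ℝ → ℂ} (hF : ∀ s : ℝ, HasDerivAt F ((I - 1) * s * F s) s) (c : ℂ)
    (s : ℝ) : deriv (fun r : ℝ => c * F r) s = c * ((I - 1) * s * F s) :=
  ((hF s).const_mul c).deriv

/-- `d/ds (c (i−1) s F) = c ((i−1)F + (i−1)s·(i−1)sF)`. [folklore] -/
private theorem deriv_diag₂ {F : ℝ → ℂ} (hF : ∀ s : ℝ, HasDerivAt F ((I - 1) * s * F s) s) (c : ℂ)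
    (s : ℝ) :
    deriv (fun r : ℝ => c * ((I - 1) * r * F r)) s =
      c * ((I - 1) * F s + (I - 1) * s * ((I - 1) * s * F s)) := by
  have h1 : HasDerivAt (fun r : ℝ => (r : ℂ)) 1 s := by
    simpa using (hasDerivAt_id s).ofReal_comp
  have h : HasDerivAt (fun r : ℝ => c * ((I - 1) * (r : ℂ) * F r))
      (c * ((I - 1) * 1 * F s + (I - 1) * s * ((I - 1) * s * F s))) s :=
    ((h1.const_mul (I - 1)).fun_mul (hF s)).const_mul c
  rw [h.deriv]
  ring

/-- `d/ds (c (is−s) F) = c ((i−1)F + (is−s)(i−1)sF)`. [folklore] -/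
private theorem deriv_offdiag {F : ℝ → ℂ} (hF : ∀ s : ℝ, HasDerivAt F ((I - 1) * s * F s) s) (c : ℂ)
    (s : ℝ) :
    deriv (fun r : ℝ => c * (I * r - r) * F r) s =
      c * ((I - 1) * F s + (I * s - s) * ((I - 1) * s * F s)) := by
  have h1 : HasDerivAt (fun r : ℝ => (r : ℂ)) 1 s := by
    simpa using (hasDerivAt_id s).ofReal_comp
  have hlin : HasDerivAt (fun r : ℝ => I * (r : ℂ) - r) (I * 1 - 1) s := (h1.const_mul I).sub h1
  have h : HasDerivAt (fun r : ℝ => c * ((I * (r : ℂ) - r) * F r))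
      (c * ((I * 1 - 1) * F s + (I * s - s) * ((I - 1) * s * F s))) s :=
    (hlin.fun_mul (hF s)).const_mul c
  have hfun : (fun r : ℝ => c * (I * r - r) * F r) = fun r : ℝ => c * ((I * (r : ℂ) - r) * F r) := by
    funext r
    ring
  rw [hfun, h.deriv]
  ring

/-- `d/ds` of the previous right-hand side (second off-diagonal derivative). [folklore] -/
private theorem deriv_offdiag₂ {F : ℝ → ℂ} (hF : ∀ s : ℝ, HasDerivAt F ((I - 1) * s * F s) s) (c : ℂ)
    (s : ℝ) :
    deriv (fun r : ℝ => c * ((I - 1) * F r + (I * r - r) * ((I - 1) * r * F r))) s =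
      c * ((I - 1) * ((I - 1) * s * F s) + ((I - 1) * ((I - 1) * s * F s) +
        (I * s - s) * ((I - 1) * F s + (I - 1) * s * ((I - 1) * s * F s)))) := by
  have h1 : HasDerivAt (fun r : ℝ => (r : ℂ)) 1 s := by
    simpa using (hasDerivAt_id s).ofReal_comp
  have hlin : HasDerivAt (fun r : ℝ => I * (r : ℂ) - r) (I * 1 - 1) s := (h1.const_mul I).sub h1
  have hA : HasDerivAt (fun r : ℝ => (I - 1) * F r) ((I - 1) * ((I - 1) * s * F s)) s :=
    (hF s).const_mul _
  have hB : HasDerivAt (fun r : ℝ => (I - 1) * (r : ℂ) * F r)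
      ((I - 1) * 1 * F s + (I - 1) * s * ((I - 1) * s * F s)) s := (h1.const_mul (I - 1)).fun_mul (hF s)
  have hC : HasDerivAt (fun r : ℝ => (I * (r : ℂ) - r) * ((I - 1) * (r : ℂ) * F r))
      ((I * 1 - 1) * ((I - 1) * s * F s) +
        (I * s - s) * ((I - 1) * 1 * F s + (I - 1) * s * ((I - 1) * s * F s))) s := hlin.fun_mul hB
  have h : HasDerivAt (fun r : ℝ => c * ((I - 1) * F r + (I * (r : ℂ) - r) * ((I - 1) * (r : ℂ) * F r)))
      (c * ((I - 1) * ((I - 1) * s * F s) + ((I * 1 - 1) * ((I - 1) * s * F s) +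
        (I * s - s) * ((I - 1) * 1 * F s + (I - 1) * s * ((I - 1) * s * F s))))) s :=
    (hA.fun_add hC).const_mul c
  rw [h.deriv]
  ring

/-! ### The derivative table for the explicit triple (§4.2 (38)–(47) p.6–8) -/

/-- `∂ₜuₓ = ν(3i−3)uₓ` on `[0,∞)`. [cite: Tyhtila2007, (47)–(48) p.8] -/
private theorem pdt_ux (ν : ℝ) (α : ℂ) (x y z : ℝ) {t : ℝ} (ht : 0 ≤ t) :
    pdt (ux ν α) x y z t = α * (I * y - y) * (I * z - z) * ((ν : ℂ) * (3 * I - 3) * E ν x y z t) := by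
  unfold pdt ux
  exact (((hasDerivAt_E_t ν x y z t).const_mul (α * (I * y - y) * (I * z - z))).hasDerivWithinAt
    ).derivWithin (uniqueDiffOn_Ici 0 t ht)

/-- `∂ₜu_y = ν(3i−3)u_y` on `[0,∞)`. [cite: Tyhtila2007, (47), (49) p.8] -/
private theorem pdt_uy (ν : ℝ) (β : ℂ) (x y z : ℝ) {t : ℝ} (ht : 0 ≤ t) :
    pdt (uy ν β) x y z t = β * (I * x - x) * (I * z - z) * ((ν : ℂ) * (3 * I - 3) * E ν x y z t) := by
  unfold pdt uy
  exact (((hasDerivAt_E_t ν x y z t).const_mul (β * (I * x - x) * (I * z - z))).hasDerivWithinAt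
    ).derivWithin (uniqueDiffOn_Ici 0 t ht)

/-- `∂ₜu_z = ν(3i−3)u_z` on `[0,∞)`. [cite: Tyhtila2007, (47), (50) p.8] -/
private theorem pdt_uz (ν : ℝ) (γ : ℂ) (x y z : ℝ) {t : ℝ} (ht : 0 ≤ t) :
    pdt (uz ν γ) x y z t = γ * (I * x - x) * (I * y - y) * ((ν : ℂ) * (3 * I - 3) * E ν x y z t) := by
  unfold pdt uz
  exact (((hasDerivAt_E_t ν x y z t).const_mul (γ * (I * x - x) * (I * y - y))).hasDerivWithinAt
    ).derivWithin (uniqueDiffOn_Ici 0 t ht)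

/-- `∂ₓp = −(1+i)·2(i−1)x·g` ((75) p.10). [cite: Tyhtila2007, (75) p.10] -/
private theorem pdx_pr (ν : ℝ) (x y z t : ℝ) :
    pdx (pr ν) x y z t = -(1 + I) * (2 * (I - 1) * x * g ν x y z t) := by
  unfold pdx pr
  exact ((hasDerivAt_g_x ν x y z t).const_mul (-(1 + I))).deriv

/-- `∂_yp = −(1+i)·2(i−1)y·g` ((76) p.11). [cite: Tyhtila2007, (76) p.11] -/
private theorem pdy_pr (ν : ℝ) (x y z t : ℝ) :
    pdy (pr ν) x y z t = -(1 + I) * (2 * (I - 1) * y * g ν x y z t) := by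
  unfold pdy pr
  exact ((hasDerivAt_g_y ν x y z t).const_mul (-(1 + I))).deriv

/-- `∂_zp = −(1+i)·2(i−1)z·g` ((77) p.11). [cite: Tyhtila2007, (77) p.11] -/
private theorem pdz_pr (ν : ℝ) (x y z t : ℝ) :
    pdz (pr ν) x y z t = -(1 + I) * (2 * (I - 1) * z * g ν x y z t) := by
  unfold pdz pr
  exact ((hasDerivAt_g_z ν x y z t).const_mul (-(1 + I))).deriv

/-- `∂ₓ²uₓ`. [cite: Tyhtila2007, (41), (44) p.8] -/
private theorem pdxx_ux (ν : ℝ) (α : ℂ) (x y z t : ℝ) :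
    pdx (pdx (ux ν α)) x y z t =
      α * (I * y - y) * (I * z - z) * ((I - 1) * E ν x y z t + (I - 1) * x * ((I - 1) * x * E ν x y z t)) := by
  have hfun : (fun s : ℝ => pdx (ux ν α) s y z t) =
      fun s : ℝ => α * (I * y - y) * (I * z - z) * ((I - 1) * s * E ν s y z t) := by
    funext s
    rw [pdx_ux]
  show deriv (fun s : ℝ => pdx (ux ν α) s y z t) x = _
  rw [hfun]
  exact deriv_diag₂ (fun s => hasDerivAt_E_x ν s y z t) _ x

/-- `∂_yuₓ`. [cite: Tyhtila2007, (38) p.6] -/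
private theorem pdy_ux (ν : ℝ) (α : ℂ) (x y z t : ℝ) :
    pdy (ux ν α) x y z t =
      α * (I * z - z) * ((I - 1) * E ν x y z t + (I * y - y) * ((I - 1) * y * E ν x y z t)) := by
  have hfun : (fun s : ℝ => ux ν α x s z t) = fun s : ℝ => α * (I * z - z) * (I * s - s) * E ν x s z t := by
    funext s
    simp only [ux]
    ring
  show deriv (fun s : ℝ => ux ν α x s z t) y = _
  rw [hfun]
  exact deriv_offdiag (fun s => hasDerivAt_E_y ν x s z t) _ y

/-- `∂_y²uₓ`. [cite: Tyhtila2007, (38), (45) p.6–8] -/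
private theorem pdyy_ux (ν : ℝ) (α : ℂ) (x y z t : ℝ) :
    pdy (pdy (ux ν α)) x y z t =
      α * (I * z - z) * ((I - 1) * ((I - 1) * y * E ν x y z t) + ((I - 1) * ((I - 1) * y * E ν x y z t) +
        (I * y - y) * ((I - 1) * E ν x y z t + (I - 1) * y * ((I - 1) * y * E ν x y z t)))) := by
  have hfun : (fun s : ℝ => pdy (ux ν α) x s z t) = fun s : ℝ =>
      α * (I * z - z) * ((I - 1) * E ν x s z t + (I * s - s) * ((I - 1) * s * E ν x s z t)) := by
    funext s
    rw [pdy_ux]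
  show deriv (fun s : ℝ => pdy (ux ν α) x s z t) y = _
  rw [hfun]
  exact deriv_offdiag₂ (fun s => hasDerivAt_E_y ν x s z t) _ y

/-- `∂_zuₓ`. [cite: Tyhtila2007, (38) p.6] -/
private theorem pdz_ux (ν : ℝ) (α : ℂ) (x y z t : ℝ) :
    pdz (ux ν α) x y z t =
      α * (I * y - y) * ((I - 1) * E ν x y z t + (I * z - z) * ((I - 1) * z * E ν x y z t)) := by
  show deriv (fun s : ℝ => ux ν α x y s t) z = _
  simp only [ux]
  exact deriv_offdiag (fun s => hasDerivAt_E_z ν x y s t) _ z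

/-- `∂_z²uₓ`. [cite: Tyhtila2007, (38), (46) p.6–8] -/
private theorem pdzz_ux (ν : ℝ) (α : ℂ) (x y z t : ℝ) :
    pdz (pdz (ux ν α)) x y z t =
      α * (I * y - y) * ((I - 1) * ((I - 1) * z * E ν x y z t) + ((I - 1) * ((I - 1) * z * E ν x y z t) +
        (I * z - z) * ((I - 1) * E ν x y z t + (I - 1) * z * ((I - 1) * z * E ν x y z t)))) := by
  have hfun : (fun s : ℝ => pdz (ux ν α) x y s t) = fun s : ℝ =>
      α * (I * y - y) * ((I - 1) * E ν x y s t + (I * s - s) * ((I - 1) * s * E ν x y s t)) := by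
    funext s
    rw [pdz_ux]
  show deriv (fun s : ℝ => pdz (ux ν α) x y s t) z = _
  rw [hfun]
  exact deriv_offdiag₂ (fun s => hasDerivAt_E_z ν x y s t) _ z

/-- `∂ₓu_y`. [cite: Tyhtila2007, (39) p.7] -/
private theorem pdx_uy (ν : ℝ) (β : ℂ) (x y z t : ℝ) :
    pdx (uy ν β) x y z t =
      β * (I * z - z) * ((I - 1) * E ν x y z t + (I * x - x) * ((I - 1) * x * E ν x y z t)) := by
  have hfun : (fun s : ℝ => uy ν β s y z t) = fun s : ℝ => β * (I * z - z) * (I * s - s) * E ν s y z t := by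
    funext s
    simp only [uy]
    ring
  show deriv (fun s : ℝ => uy ν β s y z t) x = _
  rw [hfun]
  exact deriv_offdiag (fun s => hasDerivAt_E_x ν s y z t) _ x

/-- `∂ₓ²u_y`. [cite: Tyhtila2007, (39), (44) p.7–8] -/
private theorem pdxx_uy (ν : ℝ) (β : ℂ) (x y z t : ℝ) :
    pdx (pdx (uy ν β)) x y z t =
      β * (I * z - z) * ((I - 1) * ((I - 1) * x * E ν x y z t) + ((I - 1) * ((I - 1) * x * E ν x y z t) +
        (I * x - x) * ((I - 1) * E ν x y z t + (I - 1) * x * ((I - 1) * x * E ν x y z t)))) := by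
  have hfun : (fun s : ℝ => pdx (uy ν β) s y z t) = fun s : ℝ =>
      β * (I * z - z) * ((I - 1) * E ν s y z t + (I * s - s) * ((I - 1) * s * E ν s y z t)) := by
    funext s
    rw [pdx_uy]
  show deriv (fun s : ℝ => pdx (uy ν β) s y z t) x = _
  rw [hfun]
  exact deriv_offdiag₂ (fun s => hasDerivAt_E_x ν s y z t) _ x

/-- `∂_y²u_y`. [cite: Tyhtila2007, (42), (45) p.8] -/
private theorem pdyy_uy (ν : ℝ) (β : ℂ) (x y z t : ℝ) :
    pdy (pdy (uy ν β)) x y z t =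
      β * (I * x - x) * (I * z - z) * ((I - 1) * E ν x y z t + (I - 1) * y * ((I - 1) * y * E ν x y z t)) := by
  have hfun : (fun s : ℝ => pdy (uy ν β) x s z t) =
      fun s : ℝ => β * (I * x - x) * (I * z - z) * ((I - 1) * s * E ν x s z t) := by
    funext s
    rw [pdy_uy]
  show deriv (fun s : ℝ => pdy (uy ν β) x s z t) y = _
  rw [hfun]
  exact deriv_diag₂ (fun s => hasDerivAt_E_y ν x s z t) _ y

/-- `∂_zu_y`. [cite: Tyhtila2007, (39) p.7] -/
private theorem pdz_uy (ν : ℝ) (β : ℂ) (x y z t : ℝ) :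
    pdz (uy ν β) x y z t =
      β * (I * x - x) * ((I - 1) * E ν x y z t + (I * z - z) * ((I - 1) * z * E ν x y z t)) := by
  show deriv (fun s : ℝ => uy ν β x y s t) z = _
  simp only [uy]
  exact deriv_offdiag (fun s => hasDerivAt_E_z ν x y s t) _ z

/-- `∂_z²u_y`. [cite: Tyhtila2007, (39), (46) p.7–8] -/
private theorem pdzz_uy (ν : ℝ) (β : ℂ) (x y z t : ℝ) :
    pdz (pdz (uy ν β)) x y z t =
      β * (I * x - x) * ((I - 1) * ((I - 1) * z * E ν x y z t) + ((I - 1) * ((I - 1) * z * E ν x y z t) +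
        (I * z - z) * ((I - 1) * E ν x y z t + (I - 1) * z * ((I - 1) * z * E ν x y z t)))) := by
  have hfun : (fun s : ℝ => pdz (uy ν β) x y s t) = fun s : ℝ =>
      β * (I * x - x) * ((I - 1) * E ν x y s t + (I * s - s) * ((I - 1) * s * E ν x y s t)) := by
    funext s
    rw [pdz_uy]
  show deriv (fun s : ℝ => pdz (uy ν β) x y s t) z = _
  rw [hfun]
  exact deriv_offdiag₂ (fun s => hasDerivAt_E_z ν x y s t) _ z

/-- `∂ₓu_z`. [cite: Tyhtila2007, (40) p.7] -/
private theorem pdx_uz (ν : ℝ) (γ : ℂ) (x y z t : ℝ) :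
    pdx (uz ν γ) x y z t =
      γ * (I * y - y) * ((I - 1) * E ν x y z t + (I * x - x) * ((I - 1) * x * E ν x y z t)) := by
  have hfun : (fun s : ℝ => uz ν γ s y z t) = fun s : ℝ => γ * (I * y - y) * (I * s - s) * E ν s y z t := by
    funext s
    simp only [uz]
    ring
  show deriv (fun s : ℝ => uz ν γ s y z t) x = _
  rw [hfun]
  exact deriv_offdiag (fun s => hasDerivAt_E_x ν s y z t) _ x

/-- `∂ₓ²u_z`. [cite: Tyhtila2007, (40), (44) p.7–8] -/
private theorem pdxx_uz (ν : ℝ) (γ : ℂ) (x y z t : ℝ) :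
    pdx (pdx (uz ν γ)) x y z t =
      γ * (I * y - y) * ((I - 1) * ((I - 1) * x * E ν x y z t) + ((I - 1) * ((I - 1) * x * E ν x y z t) +
        (I * x - x) * ((I - 1) * E ν x y z t + (I - 1) * x * ((I - 1) * x * E ν x y z t)))) := by
  have hfun : (fun s : ℝ => pdx (uz ν γ) s y z t) = fun s : ℝ =>
      γ * (I * y - y) * ((I - 1) * E ν s y z t + (I * s - s) * ((I - 1) * s * E ν s y z t)) := by
    funext s
    rw [pdx_uz]
  show deriv (fun s : ℝ => pdx (uz ν γ) s y z t) x = _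
  rw [hfun]
  exact deriv_offdiag₂ (fun s => hasDerivAt_E_x ν s y z t) _ x

/-- `∂_yu_z`. [cite: Tyhtila2007, (40) p.7] -/
private theorem pdy_uz (ν : ℝ) (γ : ℂ) (x y z t : ℝ) :
    pdy (uz ν γ) x y z t =
      γ * (I * x - x) * ((I - 1) * E ν x y z t + (I * y - y) * ((I - 1) * y * E ν x y z t)) := by
  show deriv (fun s : ℝ => uz ν γ x s z t) y = _
  simp only [uz]
  exact deriv_offdiag (fun s => hasDerivAt_E_y ν x s z t) _ y

/-- `∂_y²u_z`. [cite: Tyhtila2007, (40), (45) p.7–8] -/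
private theorem pdyy_uz (ν : ℝ) (γ : ℂ) (x y z t : ℝ) :
    pdy (pdy (uz ν γ)) x y z t =
      γ * (I * x - x) * ((I - 1) * ((I - 1) * y * E ν x y z t) + ((I - 1) * ((I - 1) * y * E ν x y z t) +
        (I * y - y) * ((I - 1) * E ν x y z t + (I - 1) * y * ((I - 1) * y * E ν x y z t)))) := by
  have hfun : (fun s : ℝ => pdy (uz ν γ) x s z t) = fun s : ℝ =>
      γ * (I * x - x) * ((I - 1) * E ν x s z t + (I * s - s) * ((I - 1) * s * E ν x s z t)) := by
    funext s
    rw [pdy_uz]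
  show deriv (fun s : ℝ => pdy (uz ν γ) x s z t) y = _
  rw [hfun]
  exact deriv_offdiag₂ (fun s => hasDerivAt_E_y ν x s z t) _ y

/-- `∂_z²u_z`. [cite: Tyhtila2007, (43), (46) p.8] -/
private theorem pdzz_uz (ν : ℝ) (γ : ℂ) (x y z t : ℝ) :
    pdz (pdz (uz ν γ)) x y z t =
      γ * (I * x - x) * (I * y - y) * ((I - 1) * E ν x y z t + (I - 1) * z * ((I - 1) * z * E ν x y z t)) := by
  have hfun : (fun s : ℝ => pdz (uz ν γ) x y s t) =
      fun s : ℝ => γ * (I * x - x) * (I * y - y) * ((I - 1) * s * E ν x y s t) := by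
    funext s
    rw [pdz_uz]
  show deriv (fun s : ℝ => pdz (uz ν γ) x y s t) z = _
  rw [hfun]
  exact deriv_diag₂ (fun s => hasDerivAt_E_z ν x y s t) _ z

/-- **STEP 3 holds** (§4.2–§4.3 (38)–(47), (55)–(57) pp.5–9): for `ν > 0` and `α + β + γ = 0`, the
momentum equations (3)–(5) for the explicit triple (48)–(50) with `p = −(1+i)g` (78) and the force
(72)–(74) are EQUIVALENT, at every point of `ℝ³ × [0,∞)`, to the algebraic system (55)–(57): the
derivative table of §4.2 is exact on the divergence-free family (the convective remainder is
`(i−1)³xyzE(α+β+γ)u_k = 0`, and `∂ₜu_k = 3ν(i−1)u_k` turns the Laplacian's `7ν(i−1)` into the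
bracket's `4ν(i−1)`). Discharge of the typist's «reads TRUE» flag; the row's locator `Step_4` (#77)
and the kernel objects `SoloRefuteTyhtila2007.*` are untouched. [cite: Tyhtila2007, (38)–(47) pp.6–8; (55)–(57) p.9] -/
theorem step_3_system55_holds : Step_3_system55 := by
  intro ν _hν α β γ hsum
  have hp : (1 + I) * (I - 1) = -2 := by linear_combination Complex.I_sq
  have h4 : (I - 1) ^ 4 = -4 := by linear_combination (I ^ 2 - 4 * I + 5) * Complex.I_sq
  unfold MomentumPDE Sys55
  refine forall_congr' fun x => forall_congr' fun y => forall_congr' fun z =>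
    forall_congr' fun t => forall_congr' fun ht => ?_
  simp only [lap, conv]
  rw [pdt_ux ν α x y z ht, pdt_uy ν β x y z ht, pdt_uz ν γ x y z ht, pdx_pr, pdy_pr, pdz_pr,
    pdxx_ux, pdyy_ux, pdzz_ux, pdxx_uy, pdyy_uy, pdzz_uy, pdxx_uz, pdyy_uz, pdzz_uz,
    pdx_ux, pdy_ux, pdz_ux, pdx_uy, pdy_uy, pdz_uy, pdx_uz, pdy_uz, pdz_uz]
  simp only [crossX, crossY, crossZ, fx, fy, fz, bracket, ux, uy, uz, g_eq_E_sq]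
  set e : ℂ := E ν x y z t with he
  constructor
  · rintro ⟨m1, m2, m3⟩
    refine ⟨?_, ?_, ?_⟩
    · linear_combination m1 - (α * (I - 1) ^ 5 * x * y ^ 2 * z ^ 2 * e ^ 2) * hsum
        + (2 * x * e ^ 2) * hp - ((β * z ^ 2 + γ * y ^ 2) * α * x * e ^ 2) * h4
    · linear_combination m2 - (β * (I - 1) ^ 5 * y * x ^ 2 * z ^ 2 * e ^ 2) * hsum
        + (2 * y * e ^ 2) * hp - ((α * z ^ 2 + γ * x ^ 2) * β * y * e ^ 2) * h4
    · linear_combination m3 - (γ * (I - 1) ^ 5 * z * x ^ 2 * y ^ 2 * e ^ 2) * hsum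
        + (2 * z * e ^ 2) * hp - ((α * y ^ 2 + β * x ^ 2) * γ * z * e ^ 2) * h4
  · rintro ⟨s1, s2, s3⟩
    refine ⟨?_, ?_, ?_⟩
    · linear_combination s1 + (α * (I - 1) ^ 5 * x * y ^ 2 * z ^ 2 * e ^ 2) * hsum
        - (2 * x * e ^ 2) * hp + ((β * z ^ 2 + γ * y ^ 2) * α * x * e ^ 2) * h4
    · linear_combination s2 + (β * (I - 1) ^ 5 * y * x ^ 2 * z ^ 2 * e ^ 2) * hsum
        - (2 * y * e ^ 2) * hp + ((α * z ^ 2 + γ * x ^ 2) * β * y * e ^ 2) * h4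
    · linear_combination s3 + (γ * (I - 1) ^ 5 * z * x ^ 2 * y ^ 2 * e ^ 2) * hsum
        - (2 * z * e ^ 2) * hp + ((α * y ^ 2 + β * x ^ 2) * γ * z * e ^ 2) * h4

end

end Literature.Claims.NS.Tyhtila2007
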